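/-
Copyright: lit-balaban cell, Phase-2 proof seat p33 (gen 7).  Statement-level skeleton of a published paper; no proof claims beyond
what the kernel checks below.
-/
import Literature.MathematicalPhysics.QuantumFieldTheory.BalabanImbrieJaffe1984to88.BIJ85Eq454PlaqResidual
import Literature.MathematicalPhysics.QuantumFieldTheory.BalabanImbrieJaffe1984to88.BIJ85Claim73Smooth
import Literature.MathematicalPhysics.QuantumFieldTheory.BalabanImbrieJaffe1984to88.BIJ85Claim73Background

/-!
# `BalabanImbrieJaffe1984to88.BIJ85Claim73Residual` — T. Bałaban, J. Imbrie, A. Jaffe, *Renormalization of the Higgs model: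
minimizers, propagators and the stability of mean field theory*, Commun. Math. Phys. **97** (1985) 299–329
[BalabanImbrieJaffe1985]: **(7.3.1) ⇒ (7.3.2) FOR THE ACTUAL BACKGROUND (4.5.4) `u_k = Q^{s*}_kv·exp[−ie_kη(𝒟_k∂^*Q^{e*}_kf^{(k)})]`
COMPUTED FROM `v` WITH THE OPERATORS OF RECORD**, the printed hypothesis (7.3.1) `|v(∂p) − 1| ≤ e_k𝓅(e_k)` on the UNIT-LATTICE field `v`
being USED, through the gauge-invariant route of the paper (Remark 2 p. 317: `u_k(∂p) = exp(ie_kη²f_k(p))`, file A `BIJ85Eq454PlaqResidual`;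
then seat p11's (7.3.2) at a general background `BIJ85Ineq732General.ineq732_general_phys` with `θ = e_kη²·sup|f_k|`): r15's typed
`ScalarStabData.Claim73 𝓅` HOLDS for the family of actual Sect. 7.3 data over every torus of dimension `d ≥ 2`, every `1 ≤ k ≤ m + K`, every
`0 < e_k ≤ 1`, EVERY unit-lattice `U(1)` field `v`, at which the RESIDUAL OPERATOR `R_k = (I − ∂G_{k,Ax}∂^*)Q^{e*}_k` of (4.2.6) has the
sup-norm property `|f_k(p)| ≤ K_R·max|f|` — constants `γ = min(a/(9(d+1)), 1/12)`, `α = ½`, `M = (4/3)d⁴((π/2)K_R)²(1+4𝓅₊)^{2𝓅₊}`.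
File B of this seat's gen-7 member of SKELETON row **C1.Eq7.3.1-7.3.2** (owner r15, referee ref-5); file C `BIJ85Claim73ActualOne` PROVES the
sup-norm property at `k = 1` on every torus (constant from `(d, L)`), making the first renormalization step hypothesis-free.

RELATION TO gen 6's `BIJ85Claim73Background.claim73_actual` (same seat): there the located input was the `ℓ^∞ → ℓ^∞` bound of the
smoothing operator `𝒟_k∂^*Q^{e*}_k` itself; that operator produces the vector potential of the thin flux tubes `Q^{e*}_kf` (flux `f(p′)`
concentrated on the `L^{k(d−2)}` edge plaquettes `B^e_k(p′)`), whose sup norm is — heuristically, by the `1/dist` growth of such a potential —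
of size `∼ L^k`, not uniform in `k`; so that route is a bounded-`k` small-coupling regime (seat reading note, HOME/GAPS.md G-C1-05).  The input
HERE — boundedness of the residual FIELD STRENGTH `f_k`, the curvature of the constrained minimizer — is gauge invariant and is the content of
the closing paragraph of p. 326 (*"u_k can be transformed … into a configuration of the form exp[ie_kηA], where A is smooth and small"*); the
paper derives it from Sect. 7.2 (for exact `f = ∂B` one has `f_k = ∂H_{k,Ax}B = ∂H_kB` by (5.3.1) and (5.2.8), so the gradient member of
(7.2.2), row C1.Eq7.2.1-7.2.2, is the relevant estimate) — NOT kernel-checked here.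

statement-level skeleton of published theorems with citation tags; proofs where landed; nothing here is a claim about the Yang–Mills mass gap

PDF held: `paper:balaban1985-cmp97-bij-higgs-minimizers` (journal page = PDF page + 298).  Pages read this session (`lit read`, OCR text):
p. 311 [PDF 13], p. 313 [PDF 15], p. 317 [PDF 19], p. 326 [PDF 28].

CITATION HEADER (lean-in-tree rule).  Phase-2 file of the lit-balaban TYPED SKELETON (HOME `run/shared/lean/pub/lit-balaban/`), seat p33 gen 7
(unit `lit-balaban-p33-g7`; TAKING line HOME/STATUS.md 2026-08-21T18:54:37Z).  Objects BY NAME: file A's `resE`/`actualBg`/`actualBgU1`/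
`norm_plaqC_actualBgU1_sub_one_le`, p11's `ineq732_general_phys`/`sq_hyp731_le`/`lineIter`/`QlinK`/`CoarseSpK`/`exists_GK`/`cPhys`, r15's
`ScalarStabData`/`Hyp731`/`Ineq732`/`Claim73`, gen 6's `abs_arg_le_of_norm_eq_one`.  Definitions with bodies: the index `ResIdx` (its field `hR`
is the located sup-norm property, stated in place — no `def … : Prop`), `resG` (THE inverse (4.6.2) at `u_k`), the datum `resStabData`.  No named
fact (D-0026).

THE PRINTED TEXT, verbatim (p. 326 [PDF 28]): *"In particular, let us assume that for the unit lattice field v, |v(∂p) − 1| ≤ e_k𝓅(e_k), (7.3.1)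
where 𝓅(e_k) = (1 + ln e_k^{−1})^𝓅. Then the stability estimate can be stated in two forms. For constants γ > 0, α > 0, M < ∞, ⟨φ, Δ_k(u_k)φ⟩ ≥
γ Σ_{b∈T₁^{(k)}} |u_k(b)φ(b₊) − φ(b₋)|² − Me_k^{2−α} Σ_{x∈T₁^{(k)}} |φ(x)|². (7.3.2) … by change of gauge u_k can be transformed in a local region Λ
into a configuration of the form exp[ie_kηA], where A is smooth and small."*

WHAT IS PROVED (0 `sorry`, standard axioms).
* §1 `abs_plaqField_le_of_dev` — `|(ie)^{−1} ln v(∂p)| ≤ (π/2)·|v(∂p) − 1|/e` (branch (2.11), Jordan's inequality via gen 6's lemma);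
  `ResIdx d K_R`, `resG`, `resStabData` (the MODEL INSTANCE of r15's carrier at the actual background: `plaqDev p′ = |v(∂p′) − 1|` — the PRINTED
  quantity of (7.3.1) —, `covDiffSq ψ b = |u_k(b)ψ(b₊) − ψ(b₋)|²` with `u_k(b)` the transport of `u_k` along the unit bond `b` (first printed
  form), `absSq`, `deltaForm ψ = ⟨ψ, Δ_k(u_k)ψ⟩` with the printed `a_k`, physical normalization, THE inverse (4.6.2) at `u_k`).
* §2 `KR_nonneg`; `theta_of_hyp731_res` ((7.3.1) ⇒ `‖u_k(∂p) − 1‖ ≤ e_kη²K_R(π/2)𝓅(e_k)` for all oriented η-plaquettes);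
  **`ineq732_resStabData`** (`Hyp731 𝓅 → Ineq732 (min(a/(9(d+1)),1/12)) ½ ((4/3)d⁴((π/2)K_R)²(1+4𝓅₊)^{2𝓅₊})`);
  **`claim73_residual`** (`Claim73 𝓅 (resStabData a)` over `ResIdx d K_R`).
* §3 `exists_resBound` — on each torus and scale the sup-norm property holds with SOME constant (finite dimension), so the family is inhabited
  torus by torus; the located content of `hR` is the UNIFORMITY of `K_R` (in `k`, `L^m`, `v`), i.e. the regularity (7.2.2) of the minimizers.
HONEST SCOPE.  (i) `K_R` uniform is the hypothesis `hR` of the index (discharged at `k = 1` in file C; for general `k` it is row C1.Eq7.2.1-7.2.2's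
∇H-member composed with (5.3.1)/(5.2.8) and a local axial gauge — not done here).  (ii) First printed form of (7.3.2); `0 < e_k ≤ 1`; base level
`0` (the η-lattice is `T^{(0)}`, the unit lattice `T^{(k)}`; the scalar-field carriers are indexed by `0 + k`).  (iii) Constants not optimized.
-/

open scoped RealInnerProductSpace BigOperators
open Finset

namespace Literature.MathematicalPhysics.QuantumFieldTheory.BalabanImbrieJaffe1984to88.BIJ85Claim73Residual

open Literature.MathematicalPhysics.QuantumFieldTheory.Balaban1983to89
open BIJ88Sect3Statements (U1 toC toC_one toC_mul norm_toC)
open BIJ85Sect1Model (U1Field plaq)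
open BIJ85SmallFieldSplit64 (plaqField)
open BIJ85BlockAveragesTorus BIJ85BlockAveragesTorusK BIJ85ScalarPropagatorTorus BIJ85ScalarPropagatorTorusK
open BIJ85ScalarForm464 BIJ85BlockAveragingIneq BIJ85Ineq732Flat BIJ85Ineq732General
open BIJ85AbelianStokes (plaqC)
open BIJ85AxialPropagator411 (PlaqSpace curlOp V411)
open BIJ85SigmaForm421 (curlG)
open BIJ85Sigma421Torus (toU QesOp)
open BIJ85Sigma422Eta (eta_pos)
open BIJ85Eq454PlaqResidual
open BIJ85Claim73Background (abs_arg_le_of_norm_eq_one)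

noncomputable section

/-! ## §1 The plaquette field under (7.3.1); the index, THE inverse (4.6.2), the datum -/

/-- kernel: the branch (2.11) `argB` has the modulus of the principal argument. [cite: BalabanImbrieJaffe1985, (2.11) p.303] -/
theorem abs_argB_eq (z : ℂ) : |BIJ85Sect1Model.argB z| = |Complex.arg z| := by
  unfold BIJ85Sect1Model.argB
  split_ifs with h
  · rw [h, abs_neg]
  · rfl

/-- **`|f^{(k)}(p)| ≤ (π/2)·|v(∂p) − 1|/e`** for `f^{(k)} = (ie)^{−1} ln v(∂p)` ((4.2.4), branch (2.11)) and `e > 0` — so (7.3.1) `|v(∂p) − 1| ≤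
e𝓅` gives `|f^{(k)}(p)| ≤ (π/2)𝓅` (Jordan's inequality, gen 6's `abs_arg_le_of_norm_eq_one`). [cite: BalabanImbrieJaffe1985, (7.3.1) p.326] -/
theorem abs_plaqField_le_of_dev {P : Params} {j : ℕ} {e : ℝ} (he : 0 < e) (v : U1Field P j) (p : Balaban1983to89.Plaq P j) :
    |plaqField e v p| ≤ Real.pi / 2 * ‖((plaq v p : Circle) : ℂ) - 1‖ / e := by
  unfold plaqField
  rw [abs_div, abs_of_pos he, abs_argB_eq]
  exact div_le_div_of_nonneg_right (abs_arg_le_of_norm_eq_one _ (Circle.norm_coe _)) he.le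

/-- Index of the family of ACTUAL Sect. 7.3 data at residual constant `K_R`: a torus `P` of dimension `d ≥ 2`, a scale `1 ≤ k ≤ m + K`, the
coupling `0 < e_k ≤ 1`, ANY unit-lattice `U(1)` field `v` on `T^{(k)}`, and — the located input (p. 326 / Sect. 7.2) — the sup-norm property of
the residual operator `R_k = (I − ∂G_{k,Ax}∂^*)Q^{e*}_k` of (4.2.6) at constant `K_R`: `|f_k(p)| ≤ K_R·C` whenever `|f(q)| ≤ C` for all `q` (in the
Euclidean encoding of file A, `resE = √w·f_k`, `w = η^d`).  NO hypothesis on `v`. [cite: BalabanImbrieJaffe1985, (7.3.1) p.326] -/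
structure ResIdx (d : ℕ) (KR : ℝ) where
  P : Params
  hd : P.d = d
  hd2 : 2 ≤ P.d
  k : ℕ
  hk1 : 1 ≤ k
  hk : k ≤ P.m + P.K
  e : ℝ
  he : 0 < e
  he1 : e ≤ 1
  v : U1Field P k
  hR : ∀ (g : Balaban1983to89.Plaq P k → ℝ) (C : ℝ), (∀ q, |g q| ≤ C) →
    ∀ p : Balaban1983to89.Plaq P 0, |resE hd2 ((P.eta k) ^ P.d) (P.eta k)⁻¹ k (toU P k g) p| ≤ KR * Real.sqrt ((P.eta k) ^ P.d) * C

namespace ResIdx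

variable {d : ℕ} {KR : ℝ}

/-- kernel: the level-`0` form of the standing range, `0 + k ≤ m + K`. [cite: BalabanImbrieJaffe1985, (4.5.4) p.313] -/
theorem hk0 (i : ResIdx d KR) : 0 + i.k ≤ i.P.m + i.P.K := by have := i.hk; omega

/-- kernel: the printed `a_k > 0` (`L ≥ 3`, `k ≥ 1`). [cite: BalabanImbrieJaffe1985, (4.6.4) p.313] -/
theorem aK_pos (i : ResIdx d KR) {a : ℝ} (ha : 0 < a) : 0 < BIJ85Sect4Statements.aK a i.P.L i.k :=
  (BIJ85CoefficientAk464.aK_pos_le ha (by linarith [three_le_L i.P]) i.hk1).1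

/-- the actual background (4.5.4) of the index on the `U1` carrier (file A's `actualBgU1`). [cite: BalabanImbrieJaffe1985, (4.5.4) p.313] -/
def U (i : ResIdx d KR) : GaugeField i.P 0 U1 := actualBgU1 i.hd2 i.k i.e i.v

/-- kernel: `K_R ≥ 0` (the property at `g = 0`, `C = 1`: `resE` is linear). [cite: BalabanImbrieJaffe1985, (4.2.6) p.311] -/
theorem KR_nonneg (i : ResIdx d KR) : 0 ≤ KR := by
  have h := i.hR (fun _ => 0) 1 (fun _ => by simp) ⟨default, ⟨0, by have := i.hd2; omega⟩, ⟨1, by have := i.hd2; omega⟩, by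
    simp [Fin.lt_def]⟩
  have h0 : toU i.P i.k (fun _ => (0 : ℝ)) = 0 := by ext q; rfl
  rw [h0, resE, map_zero, map_zero, sub_zero, mul_one] at h
  have h1 : (0 : ℝ) ≤ KR * Real.sqrt ((i.P.eta i.k) ^ i.P.d) := by simpa using h
  exact nonneg_of_mul_nonneg_left (by rwa [mul_comm] at h1) (Real.sqrt_pos.2 (pow_pos (eta_pos i.P i.k) _))

end ResIdx

/-- `G_k(u_k) = [−Δ_{u_k} + a_kQ_k(u_k)^*Q_k(u_k)]^{−1}` at the ACTUAL background of the index: THE inverse (4.6.2) (exists for every background,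
p11's `exists_GK`; `Classical.choose`). [cite: BalabanImbrieJaffe1985, (4.6.2) p.313] -/
def resG {d : ℕ} {KR : ℝ} (a : ℝ) (ha : 0 < a) (i : ResIdx d KR) : FineSp i.P 0 →ₗ[ℝ] FineSp i.P 0 :=
  Classical.choose (exists_GK i.hk0 (cPhys_pos i.P i.k).ne' (i.aK_pos ha) i.U)

/-- kernel: `resG` is a right inverse of `D_u^*D_u + a_kQ_k(u)^*Q_k(u)` at `u = u_k`. [cite: BalabanImbrieJaffe1985, (4.6.2) p.313] -/
theorem resG_spec {d : ℕ} {KR : ℝ} (a : ℝ) (ha : 0 < a) (i : ResIdx d KR) (φ : FineSp i.P 0) :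
    opT (Dlin (cPhys i.P i.k) i.U) (QlinK i.U i.k) (BIJ85Sect4Statements.aK a i.P.L i.k) (resG a ha i φ) = φ :=
  (Classical.choose_spec (exists_GK i.hk0 (cPhys_pos i.P i.k).ne' (i.aK_pos ha) i.U)).1 φ

/-- **THE ACTUAL Sect. 7.3 DATUM of an index** (model instance of r15's carrier): plaquettes of the UNIT lattice `T₁^{(k)} = T^{(k)}` with the
PRINTED deviation `plaqDev p′ = |v(∂p′) − 1|` of (7.3.1); bonds and sites of the unit lattice (indexed by the level `0 + k`); scalar fields
`ψ ∈ ℓ²(T₁^{(k)})`; `covDiffSq ψ b = |u_k(b)ψ(b₊) − ψ(b₋)|²` with `u_k(b)` the transport of the ACTUAL background `u_k` (4.5.4) along `b` (first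
printed form, p11's `lineIter`); `absSq ψ x = |ψ(x)|²`; `deltaForm ψ = ⟨ψ, Δ_k(u_k)ψ⟩` ((4.6.4): printed `a_k`, physical normalization `cPhys`, THE
inverse `G_k(u_k)`); `ek = e_k`. [cite: BalabanImbrieJaffe1985, (7.3.2) p.326] -/
def resStabData {d : ℕ} {KR : ℝ} (a : ℝ) (ha : 0 < a) (i : ResIdx d KR) : BIJ85Sect7Statements.ScalarStabData where
  Plaq := Balaban1983to89.Plaq i.P i.k
  Bond := PBond i.P (0 + i.k)
  Site := Balaban1983to89.Site i.P (0 + i.k)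
  Scalar := CoarseSpK i.P 0 i.k
  ek := i.e
  plaqDev := fun p => ‖((plaq i.v p : Circle) : ℂ) - 1‖
  covDiffSq := fun ψ b => ‖toC (lineIter i.U i.k b) * ψ b.tgt - ψ b.src‖ ^ 2
  absSq := fun ψ x => ‖ψ x‖ ^ 2
  deltaForm := fun ψ => ⟪ψ, deltaOp (QlinK i.U i.k) (BIJ85Sect4Statements.aK a i.P.L i.k) (resG a ha i) ψ⟫

/-! ## §2 (7.3.1) ⇒ (7.3.2) at every index; `Claim73` -/

/-- **(7.3.1) ⇒ all oriented η-plaquette variables of the actual `u_k` are within `e_kη²·K_R(π/2)𝓅(e_k)` of `1`** — (7.3.1) bounds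
`|f^{(k)}| ≤ (π/2)𝓅(e_k)` (§1), the index's residual property bounds `|f_k| ≤ K_R(π/2)𝓅(e_k)`, and file A's `u_k(∂p) = exp(ie_kη²f_k(p))` does the
rest. [cite: BalabanImbrieJaffe1985, (7.3.1) p.326] -/
theorem theta_of_hyp731_res {d : ℕ} {KR : ℝ} (a : ℝ) (ha : 0 < a) (i : ResIdx d KR) (pexp : ℝ)
    (h : (resStabData a ha i).Hyp731 pexp) (x : Balaban1983to89.Site i.P 0) (μ ν : Fin i.P.d) :
    ‖plaqC i.U x μ ν - 1‖ ≤ i.e * (i.P.eta i.k) ^ 2 * (KR * (Real.pi / 2 * (1 + Real.log i.e⁻¹) ^ pexp)) := by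
  set calP : ℝ := (1 + Real.log i.e⁻¹) ^ pexp with hcalP
  have hcalP0 : 0 ≤ calP := by
    have hb : 0 ≤ 1 + Real.log i.e⁻¹ := by
      have := Real.log_nonneg ((one_le_inv₀ i.he).2 i.he1); linarith
    exact Real.rpow_nonneg hb _
  -- (7.3.1) ⇒ |f^{(k)}(q)| ≤ (π/2)𝓅
  have hf : ∀ q, |plaqField i.e i.v q| ≤ Real.pi / 2 * calP := by
    intro q
    have h1 := abs_plaqField_le_of_dev i.he i.v q
    have h2 : ‖((plaq i.v q : Circle) : ℂ) - 1‖ ≤ i.e * calP := h q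
    calc |plaqField i.e i.v q| ≤ Real.pi / 2 * ‖((plaq i.v q : Circle) : ℂ) - 1‖ / i.e := h1
      _ ≤ Real.pi / 2 * (i.e * calP) / i.e := by gcongr; exact i.he.le
      _ = Real.pi / 2 * calP := by rw [mul_div_assoc, mul_div_cancel_left₀ _ i.he.ne']
  -- the residual property ⇒ |resE(p)| ≤ K_R√w(π/2)𝓅
  have hres := i.hR (plaqField i.e i.v) (Real.pi / 2 * calP) hf
  have hS : 0 ≤ KR * Real.sqrt ((i.P.eta i.k) ^ i.P.d) * (Real.pi / 2 * calP) := by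
    have := i.KR_nonneg; positivity
  have hmain := norm_plaqC_actualBgU1_sub_one_le i.hd2 i.hk i.he.ne' i.v hS hres x μ ν
  have hs : Real.sqrt ((i.P.eta i.k) ^ i.P.d) ≠ 0 := (Real.sqrt_pos.2 (pow_pos (eta_pos i.P i.k) _)).ne'
  rw [abs_of_pos i.he] at hmain
  refine hmain.trans (le_of_eq ?_)
  show _ = i.e * i.P.eta i.k ^ 2 * (KR * (Real.pi / 2 * calP))
  field_simp

/-- **r15's typed (7.3.2) `Ineq732 γ α M` AT EVERY INDEX OF THE ACTUAL FAMILY under `Hyp731 𝓅`**, `γ = min(a/(9(d+1)), 1/12)`, `α = ½`,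
`M = (4/3)d⁴((π/2)K_R)²(1+4𝓅₊)^{2𝓅₊}` — p11's `ineq732_general_phys` at the actual background with `θ = e_kη²K_R(π/2)𝓅(e_k)` (so `L^{2k}θ =
e_kK_R(π/2)𝓅(e_k)`), then `(e𝓅(e))² ≤ (1+4𝓅₊)^{2𝓅₊}e^{3/2}` (`sq_hyp731_le`). [cite: BalabanImbrieJaffe1985, (7.3.2) p.326] -/
theorem ineq732_resStabData {d : ℕ} {KR : ℝ} (a : ℝ) (ha : 0 < a) (pexp : ℝ) (i : ResIdx d KR)
    (h : (resStabData a ha i).Hyp731 pexp) :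
    (resStabData a ha i).Ineq732 (min (a / (9 * (d + 1))) (1 / 12)) (1 / 2)
      (4 / 3 * (d : ℝ) ^ 4 * (Real.pi / 2 * KR) ^ 2 * (1 + 4 * max pexp 0) ^ (2 * max pexp 0)) := by
  intro ψ
  change CoarseSpK i.P 0 i.k at ψ
  have hd' : (i.P.d : ℝ) = d := by rw [i.hd]
  have hθ := theta_of_hyp731_res a ha i pexp h
  have hmain := ineq732_general_phys (j := 0) i.hk1 i.hk0 ha i.U hθ (resG_spec a ha i) ψ
  have es : ((i.P.L : ℝ) ^ i.k) ^ 2 * (i.e * (i.P.eta i.k) ^ 2 * (KR * (Real.pi / 2 * (1 + Real.log i.e⁻¹) ^ pexp)))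
      = Real.pi / 2 * KR * (i.e * (1 + Real.log i.e⁻¹) ^ pexp) := by
    have h1 := pow_mul_eta_sq i.P i.k
    calc ((i.P.L : ℝ) ^ i.k) ^ 2 * (i.e * (i.P.eta i.k) ^ 2 * (KR * (Real.pi / 2 * (1 + Real.log i.e⁻¹) ^ pexp)))
        = (((i.P.L : ℝ) ^ i.k) ^ 2 * (i.P.eta i.k) ^ 2) * (Real.pi / 2 * KR * (i.e * (1 + Real.log i.e⁻¹) ^ pexp)) := by ring
      _ = _ := by rw [h1, one_mul]
  rw [es, hd', ← sum_norm_sq_eq ψ, mul_pow] at hmain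
  have hS : 0 ≤ ∑ x : Balaban1983to89.Site i.P (0 + i.k), ‖ψ x‖ ^ 2 := sum_nonneg fun _ _ => by positivity
  have hd4 : (0 : ℝ) ≤ 4 / 3 * (d : ℝ) ^ 4 * (Real.pi / 2 * KR) ^ 2 := by positivity
  have hcmp := mul_le_mul_of_nonneg_right (mul_le_mul_of_nonneg_left (sq_hyp731_le pexp i.he i.he1) hd4) hS
  show min (a / (9 * (d + 1))) (1 / 12) * bondForm (lineIter i.U i.k) ψ
      - 4 / 3 * (d : ℝ) ^ 4 * (Real.pi / 2 * KR) ^ 2 * (1 + 4 * max pexp 0) ^ (2 * max pexp 0) * i.e ^ (2 - 1 / 2 : ℝ)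
          * ∑ x : Balaban1983to89.Site i.P (0 + i.k), ‖ψ x‖ ^ 2
      ≤ ⟪ψ, deltaOp (QlinK i.U i.k) (BIJ85Sect4Statements.aK a i.P.L i.k) (resG a ha i) ψ⟫
  nlinarith [hmain, hcmp]

/-- **r15's typed claim of Sect. 7.3 `ScalarStabData.Claim73 𝓅 fam` — "(7.3.1) ⇒ (7.3.2) for constants γ > 0, α > 0, M < ∞" chosen before
`k` and the configuration — PROVED FOR THE FAMILY OF ACTUAL Sect. 7.3 DATA** `resStabData a` over `ResIdx d K_R`: every torus of dimension
`d ≥ 2`, every `1 ≤ k ≤ m + K`, every `0 < e_k ≤ 1`, EVERY unit-lattice `U(1)` field `v`, the background being (4.5.4) COMPUTED FROM `v` with the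
operators of record and the hypothesis being the PRINTED (7.3.1) on `v`; the index carries the located sup-norm property of the residual operator
`(I − ∂G_{k,Ax}∂^*)Q^{e*}_k` at constant `K_R` (Sect. 7.2 regularity; proved at `k = 1` in file C).  Constants: `γ = min(a/(9(d+1)), 1/12)`,
`α = ½`, `M = (4/3)d⁴((π/2)K_R)²(1+4𝓅₊)^{2𝓅₊}`. [cite: BalabanImbrieJaffe1985, (7.3.1)–(7.3.2) p.326] -/
theorem claim73_residual {d : ℕ} (a : ℝ) (ha : 0 < a) (KR pexp : ℝ) :
    BIJ85Sect7Statements.ScalarStabData.Claim73 pexp (resStabData (d := d) (KR := KR) a ha) :=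
  ⟨min (a / (9 * (d + 1))) (1 / 12), 1 / 2,
    4 / 3 * (d : ℝ) ^ 4 * (Real.pi / 2 * KR) ^ 2 * (1 + 4 * max pexp 0) ^ (2 * max pexp 0),
    lt_min (by positivity) (by norm_num), by norm_num, fun i hi => ineq732_resStabData a ha pexp i hi⟩

/-! ## §3 The family is inhabited torus by torus: the residual property with SOME constant -/

/-- **On each torus and scale the residual property holds with some constant** (finite dimension: `|f_k(p)| ≤ (Σ_q Σ_{p′}|R_ke_q(p′)|)·max|f|`),
so every `(P, k, e_k, v)` is an index of `ResIdx d K` for a suitable `K = K(P, k)`; the located content of the field `hR` is that ONE `K_R` serves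
the whole family (uniformity in `k`, in the volume and in `v`) — the regularity of the minimizers, Sect. 7.2. [cite: BalabanImbrieJaffe1985, (4.2.6) p.311] -/
theorem exists_resBound {P : Params} (hd2 : 2 ≤ P.d) (k : ℕ) :
    ∃ K : ℝ, ∀ (g : Balaban1983to89.Plaq P k → ℝ) (C : ℝ), (∀ q, |g q| ≤ C) →
      ∀ p : Balaban1983to89.Plaq P 0, |resE hd2 ((P.eta k) ^ P.d) (P.eta k)⁻¹ k (toU P k g) p| ≤ K * Real.sqrt ((P.eta k) ^ P.d) * C := by
  classical
  set w : ℝ := (P.eta k) ^ P.d with hw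
  have hs : 0 < Real.sqrt w := Real.sqrt_pos.2 (pow_pos (eta_pos P k) _)
  -- the residual operator as a linear map of the unit plaquette field
  set R : (Balaban1983to89.Plaq P k → ℝ) →ₗ[ℝ] PlaqSpace P :=
    (LinearMap.id - curlG (V411 P k) (curlOp (P := P) w (P.eta k)⁻¹)) ∘ₗ QesOp (P := P) hd2 w k ∘ₗ (toU P k).toLinearMap with hR
  have hRap : ∀ g, resE hd2 w (P.eta k)⁻¹ k (toU P k g) = R g := fun g => rfl
  refine ⟨(Real.sqrt w)⁻¹ * ∑ q : Balaban1983to89.Plaq P k, ∑ p' : Balaban1983to89.Plaq P 0, |R (Pi.single q 1) p'|, ?_⟩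
  intro g C hg p
  have hC : 0 ≤ C := (abs_nonneg _).trans (hg ⟨default, ⟨0, by omega⟩, ⟨1, by omega⟩, by simp [Fin.lt_def]⟩)
  have hg' : g = ∑ q, g q • (Pi.single q (1 : ℝ) : Balaban1983to89.Plaq P k → ℝ) := by
    ext q'
    simp [Finset.sum_apply, Pi.single_apply]
  rw [hRap, hg', map_sum]
  simp only [map_smul]
  rw [show (∑ q, g q • R (Pi.single q 1)) p = ∑ q, g q * R (Pi.single q 1) p by
    simp [Finset.sum_apply]]
  calc |∑ q, g q * R (Pi.single q 1) p| ≤ ∑ q, |g q * R (Pi.single q 1) p| := Finset.abs_sum_le_sum_abs _ _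
    _ = ∑ q, |g q| * |R (Pi.single q 1) p| := by simp_rw [abs_mul]
    _ ≤ ∑ q, C * ∑ p' : Balaban1983to89.Plaq P 0, |R (Pi.single q 1) p'| := by
        refine Finset.sum_le_sum fun q _ => ?_
        exact mul_le_mul (hg q)
          (Finset.single_le_sum (f := fun p' : Balaban1983to89.Plaq P 0 => |R (Pi.single q 1) p'|) (fun p' _ => abs_nonneg _)
            (Finset.mem_univ p)) (abs_nonneg _) hC
    _ = C * ∑ q, ∑ p' : Balaban1983to89.Plaq P 0, |R (Pi.single q 1) p'| := by rw [Finset.mul_sum]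
    _ = (Real.sqrt w)⁻¹ * (∑ q, ∑ p' : Balaban1983to89.Plaq P 0, |R (Pi.single q 1) p'|) * Real.sqrt w * C := by
        field_simp

end

end Literature.MathematicalPhysics.QuantumFieldTheory.BalabanImbrieJaffe1984to88.BIJ85Claim73Residual
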